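import Mathlib.AlgebraicGeometry.IdealSheaf.Functorial
import Mathlib.AlgebraicGeometry.Pullbacks
import HarnessLib

/-!
# `𝓘 ≤ f.ker` is local: testing the vanishing of an ideal sheaf under a morphism on covers and affine charts

Topic `Literature/AlgebraicGeometry/Morphisms`; theorems only (no definition, no named fact, no instance, no
`sorry`), Mathlib-only imports.  Cell hodgecm-mathlib, F-DAG (h6) (containment locus; consumer: the finite-flat
discharge of the sheaf socket `hrep` of ★ `Morphisms/ContainmentLocusClosed`).  HC_CM is proved only modulo the 7
printed citations until rung 0 closes; nothing here is about HC.

For a morphism of schemes `f : W ⟶ X` and an ideal sheaf `𝓘 : X.IdealSheafData`, the condition `𝓘 ≤ f.ker` — `f`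
factors through the closed subscheme `V(𝓘)` (Mathlib `IsClosedImmersion.lift`), e.g. the CONTAINMENT condition
«`X_T ⊆ Z_T`» for `f` the projection `X ×_S T ⟶ X` — reads «every local section of `𝓘` dies under `f^♯`»
(`le_ker_iff_forall_app_eq_zero`; Mathlib's `Scheme.Hom.ker` is `ofIdeals (U ↦ ker f^♯_U)` and `𝓘` is an honest
ideal sheaf, so NO quasi-compactness of `f` is needed, in contrast with Mathlib's `Scheme.Hom.ker_apply` /
`Scheme.Hom.iInf_ker_openCover_map_comp`).  Consequently the condition is LOCAL ON THE SOURCE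
(`le_ker_iff_of_openCover`: test on an open cover `W_j ⟶ W`), containment is local on the test scheme
(`le_ker_fst_iff_of_openCover`: `𝓘 ≤ (X ×_S T ⟶ X).ker` iff the same along every `T_j ⟶ T ⟶ S`, Mathlib
`Scheme.Pullback.openCoverOfRight`), and it can be TESTED ON AFFINE CHARTS (`le_ker_iff_of_affine_charts`: for affine
opens `U_i` covering `X` and opens `V_{ik} ⊆ f⁻¹U_i` covering each `f⁻¹U_i`, `𝓘 ≤ f.ker` iff every
`f^♯ : Γ(X, U_i) → Γ(W, V_{ik})` kills `𝓘(U_i)` — the reduction of «`X_T ⊆ Z_T`» to commutative algebra on charts).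

## References
* [GortzWedhorn2020] U. Görtz, T. Wedhorn, *Algebraic Geometry I: Schemes*, 2nd ed. (2020), Section (4.11)
  (inverse images and schematic intersections of subschemes), Proposition 3.5 (Section (3.3): morphisms into an
  affine scheme / gluing of sections), Section (4.7) (pp. 107–108) (base change).
* [Hartshorne1977] R. Hartshorne, *Algebraic Geometry* (1977), II Prop. 5.9 (PDF p. 146) (closed subschemes and
  quasi-coherent ideal sheaves).
-/

noncomputable section

open CategoryTheory CategoryTheory.Limits AlgebraicGeometry TopologicalSpace Opposite

universe u

namespace Literature.AlgebraicGeometry.Morphisms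

variable {W X : Scheme.{u}} (f : W ⟶ X) (J : X.IdealSheafData)

/-! ## §1 `𝓘 ≤ f.ker` section-wise and its locality on the source -/

/-- **`𝓘 ≤ f.ker` iff every section of `𝓘` over every affine open dies under `f^♯`** (Mathlib's `f.ker` is the
largest ideal sheaf inside `U ↦ ker f^♯_U`, `Scheme.IdealSheafData.le_ofIdeals_iff`; no quasi-compactness).
[cite: Hartshorne1977, II Prop. 5.9 (PDF p. 146)] [cite: GortzWedhorn2020, Section (4.11)] -/
theorem le_ker_iff_forall_app_eq_zero :
    J ≤ f.ker ↔ ∀ (U : X.affineOpens) (x : Γ(X, U)), x ∈ J.ideal U → f.app U x = 0 := by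
  rw [Scheme.Hom.ker, Scheme.IdealSheafData.le_ofIdeals_iff]
  exact ⟨fun h U x hx => h U hx, fun h U x hx => h U x hx⟩

/-- The `appLE` form: if `𝓘 ≤ f.ker` then `f^♯ : Γ(X, U) → Γ(W, V)` kills `𝓘(U)` for every open `V ⊆ f⁻¹U`.
[cite: Hartshorne1977, II Prop. 5.9 (PDF p. 146)] -/
theorem appLE_eq_zero_of_le_ker (h : J ≤ f.ker) (U : X.affineOpens) (V : W.Opens) (e : V ≤ f ⁻¹ᵁ (U : X.Opens))
    (x : Γ(X, U)) (hx : x ∈ J.ideal U) : f.appLE U V e x = 0 := by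
  have h0 : f.app U x = 0 := (le_ker_iff_forall_app_eq_zero f J).1 h U x hx
  simp only [Scheme.Hom.appLE, CommRingCat.comp_apply, h0, map_zero]

/-- **`𝓘 ≤ f.ker` is local on the source**: for an open cover `(W_j ⟶ W)_j`, `𝓘 ≤ f.ker` iff
`𝓘 ≤ (W_j ⟶ W ⟶ X).ker` for every `j` (sheaf axiom on `W`; no quasi-compactness of `f`).
[cite: GortzWedhorn2020, Section (3.3) Proposition 3.5] [cite: Hartshorne1977, II Prop. 5.9 (PDF p. 146)] -/
theorem le_ker_iff_of_openCover (𝒱 : W.OpenCover) :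
    J ≤ f.ker ↔ ∀ j, J ≤ (𝒱.f j ≫ f).ker := by
  refine ⟨fun h j => h.trans (Scheme.Hom.le_ker_comp _ _), fun h => ?_⟩
  rw [le_ker_iff_forall_app_eq_zero]
  intro U s hs
  apply W.IsSheaf.section_ext
  rintro x hxU
  obtain ⟨i, x, rfl⟩ := 𝒱.exists_eq x
  simp only [homOfLE_leOfHom, map_zero, exists_and_left]
  refine ⟨𝒱.f i ''ᵁ 𝒱.f i ⁻¹ᵁ f ⁻¹ᵁ U.1, ⟨_, hxU, rfl⟩,
    Set.image_preimage_subset (𝒱.f i) (f ⁻¹ᵁ U), ?_⟩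
  apply ((𝒱.f i).appIso _).commRingCatIsoToRingEquiv.injective
  rw [map_zero, ← RingEquiv.coe_toRingHom, Iso.commRingCatIsoToRingEquiv_toRingHom,
    Scheme.Hom.appIso_hom']
  simp only [homOfLE_leOfHom, Scheme.Hom.app_eq_appLE, ← RingHom.comp_apply,
    ← CommRingCat.hom_comp, Scheme.Hom.appLE_map, Scheme.Hom.appLE_comp_appLE]
  simpa [Scheme.Hom.appLE] using! Scheme.Hom.ideal_ker_le _ _ (h i U hs)

/-- **Containment is local on the test scheme**: for `p : X ⟶ S`, `b : T ⟶ S` and an open cover `(T_j ⟶ T)_j`,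
the projection `X ×_S T ⟶ X` kills `𝓘` iff every projection `X ×_S T_j ⟶ X` does (the `X ×_S T_j` cover
`X ×_S T`, Mathlib `Scheme.Pullback.openCoverOfRight`). [cite: GortzWedhorn2020, Section (4.7) (pp. 107–108)] -/
theorem le_ker_fst_iff_of_openCover {X S T : Scheme.{u}} (p : X ⟶ S) (J : X.IdealSheafData) (b : T ⟶ S)
    (𝒰 : T.OpenCover) :
    J ≤ (pullback.fst p b).ker ↔ ∀ j, J ≤ (pullback.fst p (𝒰.f j ≫ b)).ker := by
  rw [le_ker_iff_of_openCover (pullback.fst p b) J (Scheme.Pullback.openCoverOfRight 𝒰 p b)]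
  refine forall_congr' fun j => ?_
  have hj : (Scheme.Pullback.openCoverOfRight 𝒰 p b).f j ≫ pullback.fst p b =
      pullback.fst p (𝒰.f j ≫ b) := by
    rw [Scheme.Pullback.openCoverOfRight_f]
    exact (pullback.lift_fst _ _ _).trans (Category.comp_id _)
  rw [hj]
  exact Iff.rfl

/-! ## §2 Testing `𝓘 ≤ f.ker` on affine charts -/

/-- **`𝓘 ≤ f.ker` can be tested on affine charts.**  Let `(U_i)_i` be affine opens covering `X` and, for each
`i`, `(V_{ik})_k` opens of `W` inside `f⁻¹U_i` covering `f⁻¹U_i`.  Then `𝓘 ≤ f.ker` iff for all `i, k` the ring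
map `f^♯ : Γ(X, U_i) → Γ(W, V_{ik})` kills the ideal `𝓘(U_i)`.  (A section of `𝓘` over another affine open `U'`
restricts, near any point, into a basic open `D ⊆ U' ∩ U_i` that is basic in both, where `𝓘(D)` is generated by
`𝓘(U_i)` — Mathlib `IdealSheafData.map_ideal_basicOpen`, `exists_basicOpen_le_affine_inter` — so its image under
`f^♯` vanishes on the cover `f⁻¹D ∩ V_{ik}` of `f⁻¹U'`.) [cite: GortzWedhorn2020, Section (4.11) and Section (3.3) Proposition 3.5]
[cite: Hartshorne1977, II Prop. 5.9 (PDF p. 146)] -/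
theorem le_ker_iff_of_affine_charts {ι : Type*} (U : ι → X.affineOpens) (hU : ⨆ i, (U i : X.Opens) = ⊤)
    {κ : ι → Type*} (V : ∀ i, κ i → W.Opens) (hVle : ∀ i k, V i k ≤ f ⁻¹ᵁ (U i : X.Opens))
    (hVcov : ∀ i, f ⁻¹ᵁ (U i : X.Opens) ≤ ⨆ k, V i k) :
    J ≤ f.ker ↔ ∀ i k, ∀ x ∈ J.ideal (U i), f.appLE (U i) (V i k) (hVle i k) x = 0 := by
  refine ⟨fun h i k x hx => appLE_eq_zero_of_le_ker f J h (U i) (V i k) (hVle i k) x hx, fun h => ?_⟩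
  rw [le_ker_iff_forall_app_eq_zero]
  intro U' y hy
  apply W.IsSheaf.section_ext
  intro w hw
  -- `f w ∈ U' ∩ U_i` for some `i`; pick a common basic open `D ∋ f w` and a chart `V_{ik} ∋ w`
  have hfw : f w ∈ (U' : X.Opens) := hw
  obtain ⟨i, hi⟩ : ∃ i, f w ∈ (U i : X.Opens) := by
    have : f w ∈ (⨆ i, (U i : X.Opens)) := by rw [hU]; trivial
    exact Opens.mem_iSup.mp this
  obtain ⟨r, s, hrs, hwr⟩ := exists_basicOpen_le_affine_inter U'.2 (U i).2 (f w) ⟨hfw, hi⟩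
  obtain ⟨k, hk⟩ : ∃ k, w ∈ V i k := Opens.mem_iSup.mp (hVcov i hi)
  -- the chart `O := f⁻¹D ∩ V_{ik}` of `f⁻¹U'` around `w`
  have hDU' : X.basicOpen s ≤ (U' : X.Opens) := hrs ▸ X.basicOpen_le r
  have hDUi : X.basicOpen s ≤ (U i : X.Opens) := X.basicOpen_le s
  let O : W.Opens := f ⁻¹ᵁ X.basicOpen s ⊓ V i k
  have hOU' : O ≤ f ⁻¹ᵁ (U' : X.Opens) := inf_le_left.trans (Scheme.Hom.preimage_mono f hDU')
  have hOD : O ≤ f ⁻¹ᵁ X.basicOpen s := inf_le_left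
  refine ⟨O, hOU', ⟨hrs ▸ hwr, hk⟩, ?_⟩
  rw [map_zero]
  -- `y|_D` lies in `𝓘(D) = 𝓘(U_i) · Γ(D)`
  have hyD : X.presheaf.map (homOfLE hDU').op y ∈ J.ideal (X.affineBasicOpen s) :=
    J.ideal_le_comap_ideal (U := X.affineBasicOpen s) (V := U') hDU' hy
  rw [← J.map_ideal_basicOpen (U i) s] at hyD
  -- `f^♯ : Γ(X, D) → Γ(W, O)` kills `𝓘(U_i) · Γ(D)` since `Γ(X, U_i) → Γ(W, V_{ik}) → Γ(W, O)` kills `𝓘(U_i)`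
  have hkill : (J.ideal (U i)).map (X.presheaf.map (homOfLE (X.basicOpen_le s)).op).hom ≤
      RingHom.ker (f.appLE (X.basicOpen s) O hOD).hom := by
    rw [Ideal.map_le_iff_le_comap]
    intro x hx
    rw [Ideal.mem_comap, RingHom.mem_ker, ← CommRingCat.comp_apply, Scheme.Hom.map_appLE]
    have h0 : f.appLE (U i) (V i k) (hVle i k) x = 0 := h i k x hx
    have h1 : f.appLE (U i) O (hOD.trans (Scheme.Hom.preimage_mono f hDUi)) x =
        W.presheaf.map (homOfLE (inf_le_right : O ≤ V i k)).op (f.appLE (U i) (V i k) (hVle i k) x) := by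
      rw [← CommRingCat.comp_apply, Scheme.Hom.appLE_map]
    rw [h1, h0, map_zero]
  have hres : W.presheaf.map (homOfLE hOU').op (f.app U' y) =
      f.appLE (X.basicOpen s) O hOD (X.presheaf.map (homOfLE hDU').op y) := by
    rw [← CommRingCat.comp_apply, ← CommRingCat.comp_apply, Scheme.Hom.map_appLE]
    rfl
  rw [hres]
  exact hkill hyD

end Literature.AlgebraicGeometry.Morphisms

end
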